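import Summits.CriticalPhenomena.Ising3D.IsingColumnFaceL11CensusSegmentAlg

/-!
# The `ALG` census of §7.3 on the certified `Δε` segment as kernel facts, III: kernel evaluations,
(rung, sub-window) pairs `(2,0)`, `(2,1)` (cell `pub-ising3x`, seat recog-1; paper §7.1 / §7.3)

HONEST FRAMING: lottery ticket; floor = tightest certified 3D Ising CFT bounds; no exact-solution
claim without a proof. Island framing: certified exclusion region at stated derivative order and
assumptions; not a determination of the 3D Ising critical exponents beyond that.

Kernel evaluations `algSegCheck d H k N = true` of the enumerate-and-count machine of
`IsingColumnFaceL11CensusSegmentAlg.lean` (one `decide +kernel` per rung `(d, H_d)` and sub-window `k`; this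
file ≈ 140 s of kernel time): every candidate polynomial of the rung on that sub-window has its roots in
the window COUNTED exactly (`rootCount` of `…SegmentAlgRoot.lean`), the polynomial codes strictly increase,
and the counts of the primitive candidates sum to `N`. The numbers are the Python twin's (recog-1 gen 51
`twin_alg.py`: the same enclosures and bisection, cross-checked against Sturm sequences); the kernel CONFIRMS
them here. The eighteen evaluations are spread over `…SegmentAlgA/B/C/D/E.lean` by kernel cost; `E` carries
the theorems. Pure arithmetic; no certificate, no datum, no σ–ε axiom; nothing is recognised.
lottery ticket; floor = tightest certified 3D Ising CFT bounds; no exact-solution claim without a proof.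
-/

namespace Summit.CriticalPhenomena.Ising3D
namespace ColumnFaceL11
open Set Literature.MathematicalPhysics.QuantumFieldTheory.ConformalBootstrap3D

/-- Rung `(d, H) = (2, 64)`, sub-window `[81/64, 13/10]`: every candidate counted, codes increasing, the primitive
candidates have `6713` roots in the window in total. [folklore] -/
theorem algSegCheck_2_0 : algSegCheck 2 64 0 6713 = true := by
  decide +kernel

/-- Rung `(d, H) = (2, 64)`, sub-window `[13/10, 27/20]`: every candidate counted, codes increasing, the primitive
candidates have `9337` roots in the window in total. [folklore] -/
theorem algSegCheck_2_1 : algSegCheck 2 64 1 9337 = true := by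
  decide +kernel

end ColumnFaceL11
end Summit.CriticalPhenomena.Ising3D
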